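import Summits.MatrixMultiplication.MatrixMultiplication.Theorems.OctonionicLaserOctSpectralDominanceLaserSpectral
import HarnessLib

/-!
# Route OctonionicLaser — crux `OctSpectralDominance` (stmt-MatrixMultiplication-7931), helper file 2/2 of
# the spectral laser theorem: the step inequality and the theorem for rational distributions

Continuation of `OctonionicLaserOctSpectralDominanceLaserSpectral.lean` (see there for the statement and
the references): from the spectral master inequality at the power `N = dM`
(`laser_spectral_master`) to `d · min_m H(P_m) + log₂ F(B_c) ≤ d · log₂ F(t)` for `P = c/d`
(`laser_spectral_of_counts`), through the tree's real-arithmetic core `laser_step_algebra` (with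
`ω := 3`, `V := F(B_c)^M`, `R_ε := F(t)`) and `le_of_forall_mul_le_add_err`.  Everything is proved.

## References

* [BurgisserClausenShokrollahi1997] P. Bürgisser, M. Clausen, M. A. Shokrollahi, *Algebraic Complexity
  Theory*, Springer 1997, §15.8 (15.40), Thm. 15.41 and its proof pp. 380–382.
* [Strassen1988] V. Strassen, *The asymptotic spectrum of tensors*, J. reine angew. Math. 384 (1988), §3.
-/

noncomputable section

open scoped BigOperators
open Finset

-- the tree's namespace `Summit.MatrixMultiplication.MatrixMultiplication.…` repeats a component by design
set_option linter.dupNamespace false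

namespace Summit.MatrixMultiplication.MatrixMultiplication.Theorems

open Literature.Computability.AlgebraicComplexity

/-! ## The step inequality, spectral form -/

section Step

variable {K : Type} [Field K]
variable {ι κ μ : Type} [Fintype ι] [Fintype κ] [Fintype μ] [DecidableEq ι] [DecidableEq κ]
  [DecidableEq μ]
variable {I J L : Type*} [Fintype I] [Fintype J] [Fintype L] [DecidableEq I] [DecidableEq J]
  [DecidableEq L]

/-- A product of powers with exponents supported in `S` is positive when the base is `≥ 1` on `S`.
[folklore] -/
theorem prod_pow_pos_of (S : Finset (I × J × L)) (g c : I × J × L → ℕ) (hg : ∀ s ∈ S, 1 ≤ g s)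
    (hcS : ∀ s, s ∉ S → c s = 0) : 0 < ∏ s, g s ^ c s := by
  refine Finset.prod_pos fun s _ => ?_
  by_cases hs : s ∈ S
  · exact pow_pos (hg s hs) _
  · rw [hcS s hs, pow_zero]; exact one_pos

/-- **BCS Thm. 15.41, proof, step (C) in logarithmic form at the power `N = d M`, spectral form**:
for a distribution `P = c/d` with denominator `d` supported in `S` and a universal spectral point `F`,
`N (min_m H(P_m) log 2 + (log F(B_c))/d) ≤ N log F(t) + A log(N+1) + 4 √(log 3b' + N log G) + log 96 + log b'`
with `B_c = ⟨∏ k^c, ∏ m^c, ∏ n^c⟩` (`A = |I|+|J|+|L|`, `G = |I||J||L|`, `b' = max(b,1)`; Behrend's bound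
for the Salem–Spencer loss, `(15.40)` for the type classes, `F(⟨K^M, M^M, N^M⟩) ≥ F(B_c)^M`).
[cite: BurgisserClausenShokrollahi1997, Thm. 15.41 (proof, pp. 381–382, (C))] -/
theorem laser_spectral_step (t : ι → κ → μ → K) (bI : ι → I) (bJ : κ → J) (bL : μ → L)
    (S : Finset (I × J × L)) (hS : ∀ a b c, t a b c ≠ 0 → (bI a, bJ b, bL c) ∈ S)
    {r b : ℕ} (α : I → Fin r → ℤ) (β : J → Fin r → ℤ) (γ : L → Fin r → ℤ)
    (hα : Function.Injective α) (hβ : Function.Injective β) (hγ : Function.Injective γ)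
    (hαb : ∀ i ρ, |α i ρ| ≤ b) (hβb : ∀ j ρ, |β j ρ| ≤ b)
    (htight : ∀ s ∈ S, ∀ ρ, α s.1 ρ + β s.2.1 ρ + γ s.2.2 ρ = 0)
    (k m n : I × J × L → ℕ) (eI : ∀ s, Fin (k s) × Fin (n s) → ι)
    (eJ : ∀ s, Fin (k s) × Fin (m s) → κ) (eL : ∀ s, Fin (m s) × Fin (n s) → μ)
    (εI : ∀ s, Fin (k s) × Fin (n s) → K) (εJ : ∀ s, Fin (k s) × Fin (m s) → K)
    (εL : ∀ s, Fin (m s) × Fin (n s) → K)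
    (heI : ∀ s ∈ S, ∀ u, bI (eI s u) = s.1) (heJ : ∀ s ∈ S, ∀ v, bJ (eJ s v) = s.2.1)
    (heL : ∀ s ∈ S, ∀ w, bL (eL s w) = s.2.2)
    (hεI : ∀ s ∈ S, ∀ u, εI s u * εI s u = 1) (hεJ : ∀ s ∈ S, ∀ v, εJ s v * εJ s v = 1)
    (hεL : ∀ s ∈ S, ∀ w, εL s w * εL s w = 1)
    (hmat : ∀ s ∈ S, ∀ u v w, t (eI s u) (eJ s v) (eL s w) =
      εI s u * εJ s v * εL s w * matMulTensor K (k s) (m s) (n s) u v w)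
    (hpos : ∀ s ∈ S, 1 ≤ k s ∧ 1 ≤ m s ∧ 1 ≤ n s)
    (dI : I → ℕ) (dJ : J → ℕ) (dL : L → ℕ) (hdI : ∀ s ∈ S, k s * n s = dI s.1)
    (hdJ : ∀ s ∈ S, k s * m s = dJ s.2.1) (hdL : ∀ s ∈ S, m s * n s = dL s.2.2)
    (c : I × J × L → ℕ) (hcS : ∀ s, s ∉ S → c s = 0) {d : ℕ} (hd : 0 < d) (hc : ∑ s, c s = d)
    (P : I × J × L → ℝ) (hP : ∀ s, P s = (c s : ℝ) / d)
    (M : ℕ) (hM : 0 < M) (F : SpectralMap K) (hF : IsUniversalSpectralPoint K F) (hFt : 0 < F t) :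
    ((d * M : ℕ) : ℝ) * ((min (shannonEntropy (marginalDist₁ P))
        (min (shannonEntropy (marginalDist₂ P)) (shannonEntropy (marginalDist₃ P))) +
        Real.logb 2 (F (matMulTensor K (∏ s, k s ^ c s) (∏ s, m s ^ c s) (∏ s, n s ^ c s))) / d) *
          Real.log 2) ≤
      ((d * M : ℕ) : ℝ) * Real.log (F t) +
        ((Fintype.card I + Fintype.card J + Fintype.card L : ℕ) : ℝ) *
          Real.log (((d * M : ℕ) : ℝ) + 1) +
        4 * √(Real.log ((3 * max b 1 : ℕ) : ℝ) +
          Real.log ((Fintype.card I * Fintype.card J * Fintype.card L : ℕ) : ℝ) * ((d * M : ℕ) : ℝ)) +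
        (Real.log 96 + Real.log ((max b 1 : ℕ) : ℝ)) := by
  classical
  -- the count vector `Q = M c`, its marginals, the power `N = d M`
  obtain ⟨N, hN⟩ : ∃ N : ℕ, N = d * M := ⟨_, rfl⟩
  have hN0 : 0 < N := hN ▸ Nat.mul_pos hd hM
  have hN0' : (0 : ℝ) < N := by exact_mod_cast hN0
  rw [← hN]
  set Q : I × J × L → ℕ := fun s => M * c s with hQ
  have hQS : ∀ s, s ∉ S → Q s = 0 := fun s hs => by simp [hQ, hcS s hs]
  have hQsum : ∑ s, Q s = N := by
    simp only [hQ]; rw [← Finset.mul_sum, hc, hN, mul_comm]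
  set μQ : I → ℕ := fun i => ∑ j, ∑ l, Q (i, j, l) with hμQ
  set νQ : J → ℕ := fun j => ∑ i, ∑ l, Q (i, j, l) with hνQ
  set πQ : L → ℕ := fun l => ∑ i, ∑ j, Q (i, j, l) with hπQ
  have hμsum : ∑ i, μQ i = N := by rw [← hQsum, sum_triple_eq]
  have hνsum : ∑ j, νQ j = N := by
    rw [← hQsum, sum_triple_eq, hνQ]
    exact Finset.sum_comm
  have hπsum : ∑ l, πQ l = N := by
    rw [← hQsum, sum_triple_eq, hπQ]
    calc ∑ l, ∑ i, ∑ j, Q (i, j, l) = ∑ i, ∑ l, ∑ j, Q (i, j, l) := Finset.sum_comm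
      _ = ∑ i, ∑ j, ∑ l, Q (i, j, l) := Finset.sum_congr rfl fun i _ => Finset.sum_comm
  -- the marginals of `P` are the normalised marginal types
  have hPμ : ∀ i, marginalDist₁ P i = (μQ i : ℝ) / N := by
    intro i
    simp only [marginalDist₁, hP, hμQ, hQ, hN, Nat.cast_sum, Nat.cast_mul]
    have hd0 : (d : ℝ) ≠ 0 := by exact_mod_cast hd.ne'
    have hM0 : (M : ℝ) ≠ 0 := by exact_mod_cast hM.ne'
    rw [eq_div_iff (mul_ne_zero hd0 hM0), Finset.sum_mul]
    refine Finset.sum_congr rfl fun x _ => ?_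
    rw [Finset.sum_mul]
    refine Finset.sum_congr rfl fun y _ => ?_
    field_simp
  have hPν : ∀ j, marginalDist₂ P j = (νQ j : ℝ) / N := by
    intro j
    simp only [marginalDist₂, hP, hνQ, hQ, hN, Nat.cast_sum, Nat.cast_mul]
    have hd0 : (d : ℝ) ≠ 0 := by exact_mod_cast hd.ne'
    have hM0 : (M : ℝ) ≠ 0 := by exact_mod_cast hM.ne'
    rw [eq_div_iff (mul_ne_zero hd0 hM0), Finset.sum_mul]
    refine Finset.sum_congr rfl fun x _ => ?_
    rw [Finset.sum_mul]
    refine Finset.sum_congr rfl fun y _ => ?_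
    field_simp
  have hPπ : ∀ l, marginalDist₃ P l = (πQ l : ℝ) / N := by
    intro l
    simp only [marginalDist₃, hP, hπQ, hQ, hN, Nat.cast_sum, Nat.cast_mul]
    have hd0 : (d : ℝ) ≠ 0 := by exact_mod_cast hd.ne'
    have hM0 : (M : ℝ) ≠ 0 := by exact_mod_cast hM.ne'
    rw [eq_div_iff (mul_ne_zero hd0 hM0), Finset.sum_mul]
    refine Finset.sum_congr rfl fun x _ => ?_
    rw [Finset.sum_mul]
    refine Finset.sum_congr rfl fun y _ => ?_
    field_simp
  -- the spectral master inequality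
  obtain ⟨f, hf1, hfΦ, hineq⟩ := laser_spectral_master t bI bJ bL S hS α β γ hα hβ hγ hαb hβb
    htight k m n eI eJ eL εI εJ εL heI heJ heL hεI hεJ hεL hmat hpos dI dJ dL hdI hdJ hdL Q hQS hQsum
    F hF
  -- abbreviations
  set Hmin : ℝ := min (shannonEntropy (marginalDist₁ P))
    (min (shannonEntropy (marginalDist₂ P)) (shannonEntropy (marginalDist₃ P))) with hHmin
  set Bc := matMulTensor K (∏ s, k s ^ c s) (∏ s, m s ^ c s) (∏ s, n s ^ c s) with hBc
  set Lsum : ℝ := Real.logb 2 (F Bc) / d with hLsum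
  set Acard : ℕ := Fintype.card I + Fintype.card J + Fintype.card L with hAcard
  set G : ℕ := Fintype.card I * Fintype.card J * Fintype.card L with hG
  set b' : ℕ := max b 1 with hb'
  set f' : ℕ := max f b with hf'
  obtain ⟨Tmin, hTmin⟩ : ∃ Tmin : ℕ,
      Tmin = min (typeClass N μQ).card (min (typeClass N νQ).card (typeClass N πQ).card) := ⟨_, rfl⟩
  -- the shapes at `Q = M c` are the `M`-th powers of the shapes at `c`
  have hKc : 0 < ∏ s, k s ^ c s := prod_pow_pos_of S k c (fun s hs => (hpos s hs).1) hcS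
  have hMc : 0 < ∏ s, m s ^ c s := prod_pow_pos_of S m c (fun s hs => (hpos s hs).2.1) hcS
  have hNc : 0 < ∏ s, n s ^ c s := prod_pow_pos_of S n c (fun s hs => (hpos s hs).2.2) hcS
  have hpowQ : ∀ g : I × J × L → ℕ, ∏ s, g s ^ Q s = (∏ s, g s ^ c s) ^ M := by
    intro g
    rw [← Finset.prod_pow]
    refine Finset.prod_congr rfl fun s _ => ?_
    rw [hQ, ← pow_mul, mul_comm]
  have hFBc1 : 1 ≤ F Bc := one_le_spectral_of_ne_zero hF (matMulTensor_ne_zero hKc hMc hNc)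
  have hFBc0 : 0 < F Bc := one_pos.trans_le hFBc1
  -- `F(⟨K^M, M^M, N^M⟩) ≥ F(B_c)^M`
  have hFpow : F Bc ^ M ≤ F (matMulTensor K (∏ s, k s ^ Q s) (∏ s, m s ^ Q s) (∏ s, n s ^ Q s)) := by
    rw [hpowQ k, hpowQ m, hpowQ n, ← hF.map_kroneckerPow]
    exact hF.mono _ _ (tensorRestrictsTo_matMulTensor_pow_kroneckerPow K _ _ _ M)
  set V : ℝ := F Bc ^ M with hV
  have hV0 : 0 < V := pow_pos hFBc0 M
  have hineq' : (Tmin : ℝ) * f * rothNumberNat (3 * f') * V ^ ((3 : ℝ) / 3) ≤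
      288 * (f' : ℝ) ^ 2 * (F t) ^ N := by
    have e1 : (Tmin : ℝ) = min ((typeClass N μQ).card : ℝ)
        (min ((typeClass N νQ).card : ℝ) ((typeClass N πQ).card : ℝ)) := by
      rw [hTmin, Nat.cast_min, Nat.cast_min]
    have e2 : (f' : ℝ) = max (f : ℝ) (b : ℝ) := by rw [hf', Nat.cast_max]
    have e3 : V ^ ((3 : ℝ) / 3) = V := by norm_num
    rw [e1, e2, hf', e3]
    refine le_trans ?_ hineq
    exact mul_le_mul_of_nonneg_left hFpow (by positivity)
  -- (F2) the type classes: `2^{N Hmin} ≤ (N+1)^A Tmin`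
  have hF2 : (2 : ℝ) ^ ((N : ℝ) * Hmin) ≤ ((N : ℝ) + 1) ^ Acard * Tmin := by
    have hH1 : Hmin ≤ shannonEntropy (marginalDist₁ P) := min_le_left _ _
    have hH2 : Hmin ≤ shannonEntropy (marginalDist₂ P) := (min_le_right _ _).trans (min_le_left _ _)
    have hH3 : Hmin ≤ shannonEntropy (marginalDist₃ P) :=
      (min_le_right _ _).trans (min_le_right _ _)
    have hA1 : Fintype.card I ≤ Acard := by rw [hAcard]; omega
    have hA2 : Fintype.card J ≤ Acard := by rw [hAcard]; omega
    have hA3 : Fintype.card L ≤ Acard := by rw [hAcard]; omega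
    have h1 := two_rpow_le_card_typeClass_of_le μQ hμsum (marginalDist₁ P) hPμ hH1 hA1
    have h2 := two_rpow_le_card_typeClass_of_le νQ hνsum (marginalDist₂ P) hPν hH2 hA2
    have h3 := two_rpow_le_card_typeClass_of_le πQ hπsum (marginalDist₃ P) hPπ hH3 hA3
    have hA0 : (0 : ℝ) ≤ ((N : ℝ) + 1) ^ Acard := by positivity
    have e : ((N : ℝ) + 1) ^ Acard * (Tmin : ℝ) = min (((N : ℝ) + 1) ^ Acard * (typeClass N μQ).card)
        (min (((N : ℝ) + 1) ^ Acard * (typeClass N νQ).card)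
          (((N : ℝ) + 1) ^ Acard * (typeClass N πQ).card)) := by
      rw [hTmin, Nat.cast_min, Nat.cast_min, mul_min_of_nonneg _ _ hA0, mul_min_of_nonneg _ _ hA0]
    rw [e]
    exact le_min h1 (le_min h2 h3)
  -- (F3) the value: `V^{3/3} = 2^{N Lsum}`
  have hVrpow : V ^ ((3 : ℝ) / 3) = (2 : ℝ) ^ ((N : ℝ) * (3 * Lsum / 3)) := by
    have e3 : V ^ ((3 : ℝ) / 3) = V := by norm_num
    have hd0 : (d : ℝ) ≠ 0 := by exact_mod_cast hd.ne'
    have e4 : (N : ℝ) * (3 * Lsum / 3) = Real.logb 2 (F Bc) * (M : ℝ) := by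
      rw [hLsum, hN]; push_cast; field_simp
    rw [e3, e4, Real.rpow_mul zero_le_two, Real.rpow_logb two_pos (by norm_num) hFBc0,
      Real.rpow_natCast]
  -- (F4) Behrend
  have hf'1 : 1 ≤ f' := le_trans hf1 (le_max_left _ _)
  set sB : ℝ := 4 * √(Real.log ((3 * f' : ℕ) : ℝ)) with hsB
  have hBeh : ((3 * f' : ℕ) : ℝ) * Real.exp (-sB) ≤ rothNumberNat (3 * f') := by
    rw [hsB, show -(4 * √(Real.log ((3 * f' : ℕ) : ℝ))) = -4 * √(Real.log ((3 * f' : ℕ) : ℝ)) by ring]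
    exact Behrend.roth_lower_bound
  -- (F5) `f' ≤ b' f`
  have hb'1 : 1 ≤ b' := le_max_right _ _
  have hf'le : f' ≤ b' * f := by
    rcases le_total b f with hbf | hfb
    · rw [hf', max_eq_left hbf]; exact Nat.le_mul_of_pos_left f hb'1
    · rw [hf', max_eq_right hfb]
      exact le_trans (le_max_left b 1) (Nat.le_mul_of_pos_right _ hf1)
  -- (F6) `f ≤ G^N`, so `log (3 f') ≤ log (3 b') + N log G`
  have hfG : f ≤ G ^ N := by
    refine hfΦ.trans ((Finset.card_le_univ _).trans ?_)
    simp only [Fintype.card_prod, Fintype.card_fun, Fintype.card_fin, hG]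
    rw [mul_pow, mul_pow]
    exact le_of_eq (by ring)
  have hG1 : 1 ≤ G := by
    have : 1 ≤ G ^ N := hf1.trans hfG
    rcases Nat.eq_zero_or_pos G with h0 | h0
    · rw [h0, zero_pow hN0.ne'] at this; omega
    · exact h0
  have hlog3f' : Real.log ((3 * f' : ℕ) : ℝ) ≤
      Real.log ((3 * b' : ℕ) : ℝ) + Real.log (G : ℝ) * N := by
    have h1 : ((3 * f' : ℕ) : ℝ) ≤ ((3 * b' : ℕ) : ℝ) * (G : ℝ) ^ N := by
      have : 3 * f' ≤ 3 * b' * G ^ N :=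
        calc 3 * f' ≤ 3 * (b' * f) := Nat.mul_le_mul_left 3 hf'le
          _ ≤ 3 * (b' * G ^ N) := Nat.mul_le_mul_left 3 (Nat.mul_le_mul_left _ hfG)
          _ = 3 * b' * G ^ N := by ring
      exact_mod_cast this
    have hG0 : (0 : ℝ) < G := by exact_mod_cast hG1
    calc Real.log ((3 * f' : ℕ) : ℝ) ≤ Real.log (((3 * b' : ℕ) : ℝ) * (G : ℝ) ^ N) :=
          Real.log_le_log (by positivity) h1
      _ = Real.log ((3 * b' : ℕ) : ℝ) + Real.log (G : ℝ) * N := by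
          rw [Real.log_mul (by positivity) (by positivity), Real.log_pow]; ring
  have hsB_le : sB ≤ 4 * √(Real.log ((3 * b' : ℕ) : ℝ) + Real.log (G : ℝ) * N) := by
    rw [hsB]; exact mul_le_mul_of_nonneg_left (Real.sqrt_le_sqrt hlog3f') (by norm_num)
  -- the real-arithmetic core (`ω := 3`, `R_ε := F(t)`)
  have hf0 : (0 : ℝ) < f := by exact_mod_cast hf1
  have hf'0 : (0 : ℝ) < f' := by exact_mod_cast hf'1
  have hb'0 : (0 : ℝ) < b' := by exact_mod_cast hb'1
  have hf'b : (f' : ℝ) ≤ (b' : ℝ) * f := by exact_mod_cast hf'le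
  have hBeh' : 3 * (f' : ℝ) * Real.exp (-sB) ≤ rothNumberNat (3 * f') := by
    have : ((3 * f' : ℕ) : ℝ) = 3 * (f' : ℝ) := by push_cast; ring
    rw [← this]; exact hBeh
  have hlog := laser_step_algebra (ω := 3) hineq' hF2 hVrpow hBeh' hf'b hf0 hf'0 hb'0 hFt
    (Nat.cast_nonneg _) (Real.rpow_nonneg hV0.le _)
  -- assemble
  have hcast3 : ((3 * max b 1 : ℕ) : ℝ) = ((3 * b' : ℕ) : ℝ) := by rw [hb']
  have hcastb : ((max b 1 : ℕ) : ℝ) = (b' : ℝ) := by rw [hb']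
  rw [hcast3, hcastb]
  have hG' : ((Fintype.card I * Fintype.card J * Fintype.card L : ℕ) : ℝ) = (G : ℝ) := by rw [hG]
  have hA' : ((Fintype.card I + Fintype.card J + Fintype.card L : ℕ) : ℝ) = (Acard : ℝ) := by
    rw [hAcard]
  rw [hG', hA']
  have e5 : Hmin + Real.logb 2 (F Bc) / d = Hmin + 3 * Lsum / 3 := by rw [hLsum]; ring
  rw [e5]
  linarith [hsB_le]

end Step

/-! ## The theorem for distributions with a common denominator, spectral form -/

section Rational

variable {K : Type} [Field K]
variable {ι κ μ : Type} [Fintype ι] [Fintype κ] [Fintype μ] [DecidableEq ι] [DecidableEq κ]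
  [DecidableEq μ]
variable {I J L : Type*} [Fintype I] [Fintype J] [Fintype L] [DecidableEq I] [DecidableEq J]
  [DecidableEq L]

/-- **The laser method bounds every universal spectral point** (BCS Thm. 15.41 for distributions
`P = c/d` with a common denominator, with a universal spectral point `F` in place of `R̃` and the
`F`-value of the matrix block in place of its `ω`-volume).  Let `t` carry a direct-sum decomposition
(`bI, bJ, bL`) whose support lies in the `b`-tight set `S` and whose components are, along index maps
and up to signs `εI εJ εL` (`ε² = 1`), the matrix tensors `⟨k_s, m_s, n_s⟩`, with formats consistent
with block dimensions.  Then for every count vector `c` supported in `S` with `∑ c = d ≥ 1`, writing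
`P = c/d` and `B_c = ⟨∏ k_s^{c_s}, ∏ m_s^{c_s}, ∏ n_s^{c_s}⟩`,
`d · min_m H(P_m) + log₂ F(B_c) ≤ d · log₂ F(t)` for every universal spectral point `F` — i.e.
`2^{d·min H} · F(B_c) ≤ F(t)^d`: at the power `N = dM` the construction of the printed proof restricts
`t^{⊗N}` to `⊕_Δ ⟨K, M, N⟩ ≥ ⟨|Δ|⟩ ⊗ B_c^{⊗M}` with `|Δ| ≥ 2^{N min H − o(N)}`, and `F` is monotone,
additive and multiplicative (Strassen 1988 §3).
[cite: BurgisserClausenShokrollahi1997, Thm. 15.41 (proof, pp. 380–382)] -/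
theorem laser_spectral_of_counts (t : ι → κ → μ → K) (bI : ι → I) (bJ : κ → J) (bL : μ → L)
    (S : Finset (I × J × L)) (hS : ∀ a b c, t a b c ≠ 0 → (bI a, bJ b, bL c) ∈ S)
    {r b : ℕ} (α : I → Fin r → ℤ) (β : J → Fin r → ℤ) (γ : L → Fin r → ℤ)
    (hα : Function.Injective α) (hβ : Function.Injective β) (hγ : Function.Injective γ)
    (hαb : ∀ i ρ, |α i ρ| ≤ b) (hβb : ∀ j ρ, |β j ρ| ≤ b)
    (htight : ∀ s ∈ S, ∀ ρ, α s.1 ρ + β s.2.1 ρ + γ s.2.2 ρ = 0)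
    (k m n : I × J × L → ℕ) (eI : ∀ s, Fin (k s) × Fin (n s) → ι)
    (eJ : ∀ s, Fin (k s) × Fin (m s) → κ) (eL : ∀ s, Fin (m s) × Fin (n s) → μ)
    (εI : ∀ s, Fin (k s) × Fin (n s) → K) (εJ : ∀ s, Fin (k s) × Fin (m s) → K)
    (εL : ∀ s, Fin (m s) × Fin (n s) → K)
    (heI : ∀ s ∈ S, ∀ u, bI (eI s u) = s.1) (heJ : ∀ s ∈ S, ∀ v, bJ (eJ s v) = s.2.1)
    (heL : ∀ s ∈ S, ∀ w, bL (eL s w) = s.2.2)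
    (hεI : ∀ s ∈ S, ∀ u, εI s u * εI s u = 1) (hεJ : ∀ s ∈ S, ∀ v, εJ s v * εJ s v = 1)
    (hεL : ∀ s ∈ S, ∀ w, εL s w * εL s w = 1)
    (hmat : ∀ s ∈ S, ∀ u v w, t (eI s u) (eJ s v) (eL s w) =
      εI s u * εJ s v * εL s w * matMulTensor K (k s) (m s) (n s) u v w)
    (hpos : ∀ s ∈ S, 1 ≤ k s ∧ 1 ≤ m s ∧ 1 ≤ n s)
    (dI : I → ℕ) (dJ : J → ℕ) (dL : L → ℕ) (hdI : ∀ s ∈ S, k s * n s = dI s.1)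
    (hdJ : ∀ s ∈ S, k s * m s = dJ s.2.1) (hdL : ∀ s ∈ S, m s * n s = dL s.2.2)
    (c : I × J × L → ℕ) (hcS : ∀ s, s ∉ S → c s = 0) {d : ℕ} (hd : 0 < d) (hc : ∑ s, c s = d)
    (P : I × J × L → ℝ) (hP : ∀ s, P s = (c s : ℝ) / d)
    (F : SpectralMap K) (hF : IsUniversalSpectralPoint K F) :
    (d : ℝ) * min (shannonEntropy (marginalDist₁ P))
        (min (shannonEntropy (marginalDist₂ P)) (shannonEntropy (marginalDist₃ P))) +
      Real.logb 2 (F (matMulTensor K (∏ s, k s ^ c s) (∏ s, m s ^ c s) (∏ s, n s ^ c s))) ≤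
      (d : ℝ) * Real.logb 2 (F t) := by
  classical
  -- `t ≠ 0`, so `F(t) ≥ 1`
  obtain ⟨s₀, -, hs₀c⟩ : ∃ s ∈ (Finset.univ : Finset (I × J × L)), c s ≠ 0 :=
    Finset.exists_ne_zero_of_sum_ne_zero (by rw [hc]; exact hd.ne')
  have hs₀ : s₀ ∈ S := by_contra fun h => hs₀c (hcS s₀ h)
  have ht0 : t ≠ 0 := by
    obtain ⟨hk, hm, hn⟩ := hpos s₀ hs₀
    intro h
    have e := hmat s₀ hs₀ (⟨0, hk⟩, ⟨0, hn⟩) (⟨0, hk⟩, ⟨0, hm⟩) (⟨0, hm⟩, ⟨0, hn⟩)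
    rw [h] at e
    simp only [matMulTensor, and_self, if_true, mul_one] at e
    have h1 := hεI s₀ hs₀ (⟨0, hk⟩, ⟨0, hn⟩)
    have h2 := hεJ s₀ hs₀ (⟨0, hk⟩, ⟨0, hm⟩)
    have h3 := hεL s₀ hs₀ (⟨0, hm⟩, ⟨0, hn⟩)
    have hprod : (εI s₀ (⟨0, hk⟩, ⟨0, hn⟩) * εJ s₀ (⟨0, hk⟩, ⟨0, hm⟩) * εL s₀ (⟨0, hm⟩, ⟨0, hn⟩)) *
        (εI s₀ (⟨0, hk⟩, ⟨0, hn⟩) * εJ s₀ (⟨0, hk⟩, ⟨0, hm⟩) * εL s₀ (⟨0, hm⟩, ⟨0, hn⟩)) = 1 := by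
      calc _ = (εI s₀ (⟨0, hk⟩, ⟨0, hn⟩) * εI s₀ (⟨0, hk⟩, ⟨0, hn⟩)) *
            (εJ s₀ (⟨0, hk⟩, ⟨0, hm⟩) * εJ s₀ (⟨0, hk⟩, ⟨0, hm⟩)) *
            (εL s₀ (⟨0, hm⟩, ⟨0, hn⟩) * εL s₀ (⟨0, hm⟩, ⟨0, hn⟩)) := by ring
        _ = 1 := by rw [h1, h2, h3]; ring
    rw [← e] at hprod
    simp at hprod
  have hFt1 : 1 ≤ F t := one_le_spectral_of_ne_zero hF ht0
  have hFt : 0 < F t := one_pos.trans_le hFt1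
  set Hmin : ℝ := min (shannonEntropy (marginalDist₁ P))
    (min (shannonEntropy (marginalDist₂ P)) (shannonEntropy (marginalDist₃ P))) with hHmin
  set Bc := matMulTensor K (∏ s, k s ^ c s) (∏ s, m s ^ c s) (∏ s, n s ^ c s) with hBc
  -- the error-term constants
  have hu : 0 ≤ Real.log ((3 * max b 1 : ℕ) : ℝ) := Real.log_natCast_nonneg _
  have hv : 0 ≤ Real.log ((Fintype.card I * Fintype.card J * Fintype.card L : ℕ) : ℝ) :=
    Real.log_natCast_nonneg _
  have key : (Hmin + Real.logb 2 (F Bc) / d) * Real.log 2 ≤ Real.log (F t) := by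
    refine le_of_forall_mul_le_add_err (D := d) hd
      (a := ((Fintype.card I + Fintype.card J + Fintype.card L : ℕ) : ℝ)) (e := 4)
      (w := Real.log 96 + Real.log ((max b 1 : ℕ) : ℝ)) (Nat.cast_nonneg _) (by norm_num) hu hv
      fun j hj => ?_
    exact laser_spectral_step t bI bJ bL S hS α β γ hα hβ hγ hαb hβb htight k m n eI eJ eL εI εJ εL
      heI heJ heL hεI hεJ hεL hmat hpos dI dJ dL hdI hdJ hdL c hcS hd hc P hP j hj F hF hFt
  -- divide by `log 2` and multiply by `d`
  have hlog2 : 0 < Real.log 2 := Real.log_pos one_lt_two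
  have hd0 : (0 : ℝ) < d := by exact_mod_cast hd
  have key' : Hmin + Real.logb 2 (F Bc) / d ≤ Real.logb 2 (F t) := by
    have e : Real.logb 2 (F t) = Real.log (F t) / Real.log 2 := rfl
    rw [e, le_div_iff₀ hlog2]
    exact key
  have := mul_le_mul_of_nonneg_left key' hd0.le
  rw [mul_add, mul_div_cancel₀ _ hd0.ne'] at this
  exact this

end Rational

/-! ## Registered stub form -/

section Stub

/-- **Stub `stub_laserSpectralOfCounts` of the crux skeleton of `OctSpectralDominance`
(stmt-MatrixMultiplication-7931, line `registered`)**: the ∀-closed form of `laser_spectral_of_counts`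
(labels in `Type`). [cite: BurgisserClausenShokrollahi1997, Thm. 15.41] -/
theorem stub_laserSpectralOfCounts :
    ∀ {K : Type} [Field K] {ι κ μ : Type} [Fintype ι] [Fintype κ] [Fintype μ] [DecidableEq ι] [DecidableEq κ] [DecidableEq μ] {I J L : Type} [Fintype I] [Fintype J] [Fintype L] [DecidableEq I] [DecidableEq J] [DecidableEq L] (t : ι → κ → μ → K) (bI : ι → I) (bJ : κ → J) (bL : μ → L) (S : Finset (I × J × L)), (∀ a b c, t a b c ≠ 0 → (bI a, bJ b, bL c) ∈ S) → ∀ {r b : ℕ} (α : I → Fin r → ℤ) (β : J → Fin r → ℤ) (γ : L → Fin r → ℤ), Function.Injective α → Function.Injective β → Function.Injective γ → (∀ i ρ, |α i ρ| ≤ b) → (∀ j ρ, |β j ρ| ≤ b) → (∀ s ∈ S, ∀ ρ, α s.1 ρ + β s.2.1 ρ + γ s.2.2 ρ = 0) → ∀ (k m n : I × J × L → ℕ) (eI : ∀ s, Fin (k s) × Fin (n s) → ι) (eJ : ∀ s, Fin (k s) × Fin (m s) → κ) (eL : ∀ s, Fin (m s) × Fin (n s) → μ) (εI : ∀ s, Fin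 (k s) × Fin (n s) → K) (εJ : ∀ s, Fin (k s) × Fin (m s) → K) (εL : ∀ s, Fin (m s) × Fin (n s) → K), (∀ s ∈ S, ∀ u, bI (eI s u) = s.1) → (∀ s ∈ S, ∀ v, bJ (eJ s v) = s.2.1) → (∀ s ∈ S, ∀ w, bL (eL s w) = s.2.2) → (∀ s ∈ S, ∀ u, εI s u * εI s u = 1) → (∀ s ∈ S, ∀ v, εJ s v * εJ s v = 1) → (∀ s ∈ S, ∀ w, εL s w * εL s w = 1) → (∀ s ∈ S, ∀ u v w, t (eI s u) (eJ s v) (eL s w) = εI s u * εJ s v * εL s w * matMulTensor K (k s) (m s) (n s) u v w) → (∀ s ∈ S, 1 ≤ k s ∧ 1 ≤ m s ∧ 1 ≤ n s) → ∀ (dI : I → ℕ) (dJ : J → ℕ) (dL : L → ℕ), (∀ s ∈ S, k s * n s = dI s.1) → (∀ s ∈ S, k s * m s = dJ s.2.1) → (∀ s ∈ S, m s * n s = dL s.2.2) → ∀ (c : I × J × L → ℕ), (∀ s, s ∉ S → c s = 0) → ∀ {d : ℕ}, 0 < d → ∑ s, c s = d → ∀ (P : I × J × L → ℝ), (∀ s,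 P s = (c s : ℝ) / d) → ∀ (F : SpectralMap K), IsUniversalSpectralPoint K F → (d : ℝ) * min (shannonEntropy (marginalDist₁ P)) (min (shannonEntropy (marginalDist₂ P)) (shannonEntropy (marginalDist₃ P))) + Real.logb 2 (F (matMulTensor K (∏ s, k s ^ c s) (∏ s, m s ^ c s) (∏ s, n s ^ c s))) ≤ (d : ℝ) * Real.logb 2 (F t) := by
  intro K _ ι κ μ _ _ _ _ _ _ I J L _ _ _ _ _ _ t bI bJ bL S hS r b α β γ hα hβ hγ hαb hβb htight k m n eI eJ
    eL εI εJ εL heI heJ heL hεI hεJ hεL hmat hpos dI dJ dL hdI hdJ hdL c hcS d hd hc P hP F hF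
  exact laser_spectral_of_counts t bI bJ bL S hS α β γ hα hβ hγ hαb hβb htight k m n eI eJ eL εI εJ εL heI
    heJ heL hεI hεJ hεL hmat hpos dI dJ dL hdI hdJ hdL c hcS hd hc P hP F hF

end Stub

end Summit.MatrixMultiplication.MatrixMultiplication.Theorems

end
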